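import Literature.MathematicalPhysics.QuantumFieldTheory.Balaban1983to89.T4ShellMeasureFibre
import Summits.QuantumFields.BalabanUV.T4Continuum.Support.ShellMeasureLogConcave

/-!
# N21 (NE7c) · HIGH-ANCHOR (λ): the (M1) constant as the large-field fraction, and the sharp three-chord (lens Card 45 ∕ 47)

R134 seat pub-ymgap-dag-n21-d (g7), node N21 = NE7c (single-run shell-weight bound, NOT PRINTED in [Bałaban 1983–89],
NOT proved), lane K3⁶ `SpineGivenEndpointR13SepCoPR` (stmt-QuantumFields-20509, `--kind proof --supports … --as helper`).

THIS FILE = LENS ROW Λ of `ym-lens-BalabanUVNodes-nearmiss/LENS-nearmiss.md` v15.0 (first refusal dag-n21-d, the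
comparison-model ∕ G1 lineage): the §H section of the lens's `Sketch-nearmiss-g15.lean` (sha16 b6a6f083c2939408, farm
rc 0 · 0 warnings at the lens desk) VERBATIM — statements and proofs — re-homed in this namespace with this credit
header; AUTHORSHIP OF THE MATHEMATICS: planner seat `ym-lens-BalabanUVNodes-nearmiss` g15 (memo-only seat, cannot file);
this seat only files.  CONTENT (lens Card 45): pub-balaban's three-chord engine `ShellMeasureLogConcave.
slotAntiConcentration_of_logConcaveSublevel` (member (λ), 2026-08-20, BY NAME) read at the HIGH ANCHOR `r₀ = θ(1 − κ)`:
if the classifier `u` has log-concave sublevel masses on `[θ(1 − κ), θ]` and the mass ABOVE the lowered threshold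
`θ(1 − κ)` is at most the fraction `q ≤ ½` of the total — the printed SPECIES of [B15] p. 193 (a large-field small factor
at a lowered threshold) — then `SlotAntiConcentration ν u θ ρ (2q/κ)` for `ρ ≤ κ`: the (M1) constant IS the large-field
fraction; plus the SHARP chord `shell ≤ (θρ/(θ − r₀))·log M·ν{u < θ}` (Card 47's per-ray engine) from the real
interpolation inequality `x₂ − x₁ ≤ r·log M₀·z`.

HONEST FRAMING.  [folklore] measure theory ∕ real analysis over pub-balaban's typed engines (cited by name); the
log-concavity hypothesis `LogConcaveSublevelOn` and the large-field smallness (LF) are HYPOTHESES — for Bałaban's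
verbatim classifier (λ) is recorded dead (D20) by the lens's Card 46 floor; 0 def, 0 sorry; nothing of Bałaban's
asserted.  NE7c NOT PRINTED ∕ NOT proved; N21 NOT discharged; counts unmoved (typed 28∕28 · discharged 5∕27);
count-neutral; one finite 𝕋⁴ at fixed ε — nothing about ℝ⁴ ∕ OS ∕ mass gap ∕ Clay.
-/

open MeasureTheory Finset Filter
open scoped ENNReal

namespace Summit.QuantumFields.YangMills.Theorems.N21LogConcaveHighAnchor

open Literature.MathematicalPhysics.QuantumFieldTheory.Balaban1983to89
open T4IndicatorShell (ShellWeightBound)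
open T4ShellMeasure (SlotAntiConcentration SlotLedger)
open Summit.QuantumFields.BalabanUV.T4Continuum

/-! ## §H  Card 45 — high-anchor (λ): the constant is the large-field fraction; and the sharp chord (Card 47's ray engine) -/

section HighAnchor

open ShellMeasureLogConcave (LogConcaveSublevelOn slotAntiConcentration_of_logConcaveSublevel)

/-- REAL CORE of the chord.  `0 < x₀ ≤ x₂ ≤ z ≤ M₀x₀`, `1 ≤ M₀` and the interpolation `x₀^r · x₂^{1−r} ≤ x₁` (`0 ≤ r`)
give `x₂ − x₁ ≤ (r·log M₀)·z` (via `1 − e^{−L} ≤ L`; with `z := x₂` this is the SHARP form `x₂ − x₁ ≤ r·x₂·log(x₂/x₀)`). -/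
theorem sub_le_of_rpow_interpolation {x₀ x₁ x₂ z M₀ r : ℝ} (hr : 0 ≤ r) (hM₀ : 1 ≤ M₀) (hx₀ : 0 < x₀)
    (h₀₂ : x₀ ≤ x₂) (h₂z : x₂ ≤ z) (hz : z ≤ M₀ * x₀)
    (hint : x₀ ^ r * x₂ ^ (1 - r) ≤ x₁) : x₂ - x₁ ≤ (r * Real.log M₀) * z := by
  have hx₂ : 0 < x₂ := lt_of_lt_of_le hx₀ h₀₂
  have hlog : 0 ≤ Real.log M₀ := Real.log_nonneg hM₀
  have hkey : x₂ * Real.exp (-(r * Real.log M₀)) ≤ x₁ := by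
    have h1 : x₀ ^ r * x₂ ^ (1 - r) = x₂ * Real.exp (r * (Real.log x₀ - Real.log x₂)) := by
      rw [Real.rpow_def_of_pos hx₀, Real.rpow_def_of_pos hx₂, ← Real.exp_add,
        show x₂ * Real.exp (r * (Real.log x₀ - Real.log x₂)) =
          Real.exp (Real.log x₂) * Real.exp (r * (Real.log x₀ - Real.log x₂)) by rw [Real.exp_log hx₂],
        ← Real.exp_add]
      congr 1; ring
    have h2 : -(r * Real.log M₀) ≤ r * (Real.log x₀ - Real.log x₂) := by
      have : Real.log x₂ - Real.log x₀ ≤ Real.log M₀ := by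
        rw [← Real.log_div hx₂.ne' hx₀.ne']
        refine Real.log_le_log (div_pos hx₂ hx₀) ?_
        rw [div_le_iff₀ hx₀]; linarith
      nlinarith
    calc x₂ * Real.exp (-(r * Real.log M₀)) ≤ x₂ * Real.exp (r * (Real.log x₀ - Real.log x₂)) :=
          mul_le_mul_of_nonneg_left (Real.exp_le_exp.mpr h2) hx₂.le
      _ = x₀ ^ r * x₂ ^ (1 - r) := h1.symm
      _ ≤ x₁ := hint
  have hexp : 1 - r * Real.log M₀ ≤ Real.exp (-(r * Real.log M₀)) := by
    have := Real.add_one_le_exp (-(r * Real.log M₀)); linarith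
  have hrl : 0 ≤ r * Real.log M₀ := mul_nonneg hr hlog
  have h3 : x₂ * (1 - r * Real.log M₀) ≤ x₁ := (mul_le_mul_of_nonneg_left hexp hx₂.le).trans hkey
  have h4 : x₂ * (r * Real.log M₀) ≤ z * (r * Real.log M₀) := mul_le_mul_of_nonneg_right h₂z hrl
  linarith

/-- MEASURE FORM (crude, `ν(univ)`-normalised).  Sets `S₀ ⊆ S₂`, `S₁ ⊆ S₂` (`S₁` measurable) under a finite measure with
`ν S₀ ≠ 0`, `ν(univ) ≤ M₀·ν S₀` and `ν S₀^r · ν S₂^{1−r} ≤ ν S₁` (`0 ≤ r`) ⇒ `ν(S₂ \ S₁) ≤ (r·log M₀)·ν(univ)`. -/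
theorem measure_diff_le_of_rpow_interpolation {Ω : Type*} [MeasurableSpace Ω] (ν : Measure Ω) [IsFiniteMeasure ν]
    {S₀ S₁ S₂ : Set Ω} (hS₁ : MeasurableSet S₁) (h₀₂ : S₀ ⊆ S₂) (h₁₂ : S₁ ⊆ S₂) {r M₀ : ℝ} (hr : 0 ≤ r)
    (hM₀ : 1 ≤ M₀) (hpos : ν S₀ ≠ 0) (hhalf : ν Set.univ ≤ ENNReal.ofReal M₀ * ν S₀)
    (hint : ν S₀ ^ r * ν S₂ ^ (1 - r) ≤ ν S₁) :
    ν (S₂ \ S₁) ≤ ENNReal.ofReal (r * Real.log M₀) * ν Set.univ := by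
  have hM₀0 : 0 ≤ M₀ := zero_le_one.trans hM₀
  have hrl : 0 ≤ r * Real.log M₀ := mul_nonneg hr (Real.log_nonneg hM₀)
  have hfin : ∀ S : Set Ω, ν S ≠ ∞ := fun S => measure_ne_top ν S
  rw [measure_sdiff h₁₂ hS₁.nullMeasurableSet (hfin S₁),
    ← ENNReal.toReal_le_toReal (ENNReal.sub_ne_top (hfin S₂)) (ENNReal.mul_ne_top ENNReal.ofReal_ne_top (hfin _)),
    ENNReal.toReal_sub_of_le (measure_mono h₁₂) (hfin S₂), ENNReal.toReal_mul, ENNReal.toReal_ofReal hrl]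
  have hint' : (ν S₀).toReal ^ r * (ν S₂).toReal ^ (1 - r) ≤ (ν S₁).toReal := by
    rw [ENNReal.toReal_rpow, ENNReal.toReal_rpow, ← ENNReal.toReal_mul]
    exact ENNReal.toReal_mono (hfin S₁) hint
  have hhalf' : (ν Set.univ).toReal ≤ M₀ * (ν S₀).toReal := by
    have := ENNReal.toReal_mono (ENNReal.mul_ne_top ENNReal.ofReal_ne_top (hfin S₀)) hhalf
    rwa [ENNReal.toReal_mul, ENNReal.toReal_ofReal hM₀0] at this
  exact sub_le_of_rpow_interpolation hr hM₀ (ENNReal.toReal_pos hpos (hfin S₀))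
    (ENNReal.toReal_mono (hfin S₂) (measure_mono h₀₂))
    (ENNReal.toReal_mono (hfin _) (measure_mono (Set.subset_univ _))) hhalf' hint'

/-- MEASURE FORM, SHARP (`ν S₂`-normalised): the same with `ν S₂ ≤ M₀·ν S₀` ⇒ `ν(S₂ \ S₁) ≤ (r·log M₀)·ν S₂` — by
restriction to `S₂`.  With `M₀ = ν S₂/ν S₀` this is the chord `B − A ≤ λ·B·log(B/C)` that the per-ray integration of
Card 47 needs (small on typical rays through `log(B/C)`, small on sparse rays through `B`). -/
theorem measure_diff_le_of_rpow_interpolation_sharp {Ω : Type*} [MeasurableSpace Ω] (ν : Measure Ω)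
    [IsFiniteMeasure ν] {S₀ S₁ S₂ : Set Ω} (hS₀ : MeasurableSet S₀) (hS₁ : MeasurableSet S₁)
    (hS₂ : MeasurableSet S₂) (h₀₂ : S₀ ⊆ S₂) (h₁₂ : S₁ ⊆ S₂) {r M₀ : ℝ} (hr : 0 ≤ r) (hM₀ : 1 ≤ M₀)
    (hpos : ν S₀ ≠ 0) (hratio : ν S₂ ≤ ENNReal.ofReal M₀ * ν S₀) (hint : ν S₀ ^ r * ν S₂ ^ (1 - r) ≤ ν S₁) :
    ν (S₂ \ S₁) ≤ ENNReal.ofReal (r * Real.log M₀) * ν S₂ := by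
  have h0 : ν.restrict S₂ S₀ = ν S₀ := by rw [Measure.restrict_apply hS₀, Set.inter_eq_left.mpr h₀₂]
  have h1 : ν.restrict S₂ S₁ = ν S₁ := by rw [Measure.restrict_apply hS₁, Set.inter_eq_left.mpr h₁₂]
  have h2 : ν.restrict S₂ S₂ = ν S₂ := by rw [Measure.restrict_apply hS₂, Set.inter_self]
  have hu : ν.restrict S₂ Set.univ = ν S₂ := Measure.restrict_apply_univ S₂
  have hd : ν.restrict S₂ (S₂ \ S₁) = ν (S₂ \ S₁) := by
    rw [Measure.restrict_apply (hS₂.diff hS₁), Set.inter_eq_left.mpr (fun x hx => hx.1)]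
  have key := measure_diff_le_of_rpow_interpolation (ν.restrict S₂) hS₁ h₀₂ h₁₂ hr hM₀ (by rwa [h0])
    (by rwa [hu, h0]) (by rwa [h0, h2, h1])
  rwa [hd, hu] at key

variable {Ω : Type*} [MeasurableSpace Ω]

/-- **THE SHARP CHORD FOR A LOG-CONCAVE SUBLEVEL FUNCTION** (pub-balaban's `LogConcaveSublevelOn`, by name): anchor
`r₀ < θ(1 − ρ)`, `0 < ρ`, `ν{u < θ} ≤ M·ν{u < r₀}` ⇒ shell mass `≤ (θρ/(θ − r₀))·log M · ν{u < θ}` — the mass BELOW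
THRESHOLD, not `ν(univ)`, carries the bound. -/
theorem shell_le_of_logConcaveSublevel_sharp (ν : Measure Ω) [IsFiniteMeasure ν] {u : Ω → ℝ} (hu : Measurable u)
    {r₀ θ ρ M : ℝ} (hθ : 0 < θ) (hρ : 0 < ρ) (hr : r₀ < θ * (1 - ρ)) (hM : 1 ≤ M)
    (hF : LogConcaveSublevelOn ν u r₀ θ) (hpos : ν {x | u x < r₀} ≠ 0)
    (hratio : ν {x | u x < θ} ≤ ENNReal.ofReal M * ν {x | u x < r₀}) :
    ν {x | θ * (1 - ρ) ≤ u x ∧ u x < θ} ≤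
      ENNReal.ofReal (θ * ρ / (θ - r₀) * Real.log M) * ν {x | u x < θ} := by
  have hθρ : θ * (1 - ρ) < θ := by nlinarith
  have hr₀ : r₀ < θ := hr.trans hθρ
  have hθr : 0 < θ - r₀ := sub_pos.mpr hr₀
  set s := θ * ρ / (θ - r₀) with hs_def
  have hs0 : 0 < s := div_pos (mul_pos hθ hρ) hθr
  have hs1 : s < 1 := by rw [hs_def, div_lt_one hθr]; nlinarith
  have hlev : (1 - s) * θ + s * r₀ = θ * (1 - ρ) := by
    rw [hs_def]; field_simp; ring
  have hint : ν {x | u x < r₀} ^ s * ν {x | u x < θ} ^ (1 - s) ≤ ν {x | u x < θ * (1 - ρ)} := by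
    rw [mul_comm, ← hlev]
    exact hF hr₀.le le_rfl le_rfl hr₀.le hs0 hs1
  have hset : {x | θ * (1 - ρ) ≤ u x ∧ u x < θ} = {x | u x < θ} \ {x | u x < θ * (1 - ρ)} := by
    ext x
    simp only [Set.mem_setOf_eq, Set.mem_sdiff, not_lt]
    exact and_comm
  rw [hset]
  exact measure_diff_le_of_rpow_interpolation_sharp ν (measurableSet_lt hu measurable_const)
    (measurableSet_lt hu measurable_const) (measurableSet_lt hu measurable_const)
    (fun x (hx : u x < r₀) => show u x < θ from hx.trans hr₀)
    (fun x (hx : u x < θ * (1 - ρ)) => show u x < θ from hx.trans hθρ) hs0.le hM hpos hratio hint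

/-- (LF) ⇒ (HALF): if the mass ABOVE the anchor is at most the fraction `q < 1` of the total, the total is at most
`(1 − q)⁻¹` times the mass below the anchor. -/
theorem univ_le_of_largeField (ν : Measure Ω) [IsFiniteMeasure ν] {u : Ω → ℝ} (hu : Measurable u) {a q : ℝ}
    (hq0 : 0 ≤ q) (hq1 : q < 1) (hLF : ν {x | a ≤ u x} ≤ ENNReal.ofReal q * ν Set.univ) :
    ν Set.univ ≤ ENNReal.ofReal ((1 - q)⁻¹) * ν {x | u x < a} := by
  have hfin : ∀ S : Set Ω, ν S ≠ ∞ := fun S => measure_ne_top ν S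
  have hcomp : ν {x | u x < a} + ν {x | a ≤ u x} = ν Set.univ := by
    have : {x | a ≤ u x} = {x | u x < a}ᶜ := by ext x; simp only [Set.mem_setOf_eq, Set.mem_compl_iff, not_lt]
    rw [this]
    exact measure_add_measure_compl (measurableSet_lt hu measurable_const)
  have hU : (ν Set.univ).toReal = (ν {x | u x < a}).toReal + (ν {x | a ≤ u x}).toReal := by
    rw [← ENNReal.toReal_add (hfin _) (hfin _), hcomp]
  have hL : (ν {x | a ≤ u x}).toReal ≤ q * (ν Set.univ).toReal := by
    have := ENNReal.toReal_mono (ENNReal.mul_ne_top ENNReal.ofReal_ne_top (hfin _)) hLF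
    rwa [ENNReal.toReal_mul, ENNReal.toReal_ofReal hq0] at this
  have h1q : 0 < 1 - q := by linarith
  have hreal : (ν Set.univ).toReal ≤ (1 - q)⁻¹ * (ν {x | u x < a}).toReal := by
    rw [inv_mul_eq_div, le_div_iff₀ h1q]; nlinarith
  calc ν Set.univ = ENNReal.ofReal (ν Set.univ).toReal := (ENNReal.ofReal_toReal (hfin _)).symm
    _ ≤ ENNReal.ofReal ((1 - q)⁻¹ * (ν {x | u x < a}).toReal) := ENNReal.ofReal_le_ofReal hreal
    _ = ENNReal.ofReal ((1 - q)⁻¹) * ν {x | u x < a} := by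
        rw [ENNReal.ofReal_mul (inv_nonneg.mpr h1q.le), ENNReal.ofReal_toReal (hfin _)]

/-- **HIGH-ANCHOR (λ) — THE (M1) CONSTANT IS THE LARGE-FIELD FRACTION.**  pub-balaban's three-chord engine
`slotAntiConcentration_of_logConcaveSublevel` (BY NAME) with anchor `r₀ = θ(1 − κ)`, `ρ ≤ κ`, and the smallness read as
(LF) «the mass above the LOWERED threshold `θ(1 − κ)` is at most the fraction `q ≤ ½`» — the printed SPECIES of [B15]
p. 193 (large-field small factor at a lowered threshold) — gives `SlotAntiConcentration ν u θ ρ (2q/κ)`: a constant that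
is itself a small factor (`T4ShellMeasureFibre.slotAntiConcentration_mono` ∕ `neg_log_one_sub_le` BY NAME for
`−log(1−q)/κ ≤ 2q/κ`). -/
theorem slotAntiConcentration_of_logConcaveSublevel_largeField (ν : Measure Ω) [IsFiniteMeasure ν] {u : Ω → ℝ}
    (hu : Measurable u) {θ ρ κ q : ℝ} (hθ : 0 < θ) (hρ : 0 ≤ ρ) (hκ : 0 < κ) (hρκ : ρ ≤ κ) (hq0 : 0 ≤ q)
    (hq : q ≤ 1 / 2) (hF : LogConcaveSublevelOn ν u (θ * (1 - κ)) θ)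
    (hLF : ν {x | θ * (1 - κ) ≤ u x} ≤ ENNReal.ofReal q * ν Set.univ) :
    SlotAntiConcentration ν u θ ρ (2 * q / κ) := by
  have h1q : 0 < 1 - q := by linarith
  set P := -Real.log (1 - q) with hP_def
  have hP0 : 0 ≤ P := by
    rw [hP_def, neg_nonneg]; exact Real.log_nonpos h1q.le (by linarith)
  have hexpP : Real.exp P = (1 - q)⁻¹ := by rw [hP_def, Real.exp_neg, Real.exp_log h1q]
  have hmass : ν Set.univ ≤ ENNReal.ofReal (Real.exp P) * ν {x | u x < θ * (1 - κ)} := by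
    rw [hexpP]; exact univ_le_of_largeField ν hu hq0 (by linarith) hLF
  have hr₀ : θ * (1 - κ) < θ := by nlinarith
  have hr : θ * (1 - κ) ≤ θ * (1 - ρ) := mul_le_mul_of_nonneg_left (by linarith) hθ.le
  have h := slotAntiConcentration_of_logConcaveSublevel ν (measure_ne_top ν _) hu hθ.le hρ hr₀ hr hP0 hF hmass
  refine T4ShellMeasureFibre.slotAntiConcentration_mono hρ ?_ h
  have hden : θ - θ * (1 - κ) = θ * κ := by ring
  have hD : P * θ / (θ - θ * (1 - κ)) = P / κ := by rw [hden, mul_comm P θ, mul_div_mul_left P κ hθ.ne']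
  rw [hD, div_le_div_iff_of_pos_right hκ, hP_def]
  exact T4ShellMeasureFibre.neg_log_one_sub_le hq0 hq

end HighAnchor

end Summit.QuantumFields.YangMills.Theorems.N21LogConcaveHighAnchor
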